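import Literature.MathematicalPhysics.KineticTheory.DiPernaLionsScheme
import Literature.MathematicalPhysics.KineticTheory.DiPernaLionsExtraction
import HarnessLib

/-!
# The a priori bounds (3.8)–(3.9) from the conservation laws and the entropy identity

Topic: MathematicalPhysics / KineticTheory. Proofs-only companion of
`Literature.MathematicalPhysics.KineticTheory.DiPernaLionsScheme`: the named fact (A2c)
`Kinetic.approximateSolution_apriori_bounds` (Cercignani–Illner–Pulvirenti 1994 §5.3 Lemma 5.3.1
(3.8)–(3.9), pp. 141–142) is **derived** from (A2a) `Kinetic.approximateSolution_conservation`
((3.4)–(3.6)) and (A2b) `Kinetic.approximateSolution_entropy_identity` ((3.7)), following the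
printed proof: "(3.8) follows from (3.4)–(3.6) since `|x|² ≤ 2|x - tξ|² + 2t²|ξ|²`", and "(3.9)
follows from (3.7) and (3.11)", where (3.11) is Arkeryd's pointwise bound
`Kinetic.mul_abs_log_le_add` with the weight `w = |x - tv|² + |v|²`; the dimensional constant is
`C_E = 4 ∫∫ exp(-(|x|² + |v|²)/2) dx dv` (the shear `(x,v) ↦ (x - tv, v)` preserves Lebesgue
measure, `Kinetic.measurePreserving_freeShear`).

* `Kinetic.IsTruncatedProblemData.integrable_mul_of_le_sq` and consequences (**proved**):
  integrability of `f₀`, `f₀ |x|²`, `f₀ |v|²`, `f₀ |x - tv|²`, `f₀ |log f₀|`, `f₀ log f₀` for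
  admissible (positive Schwartz, `|log f₀|` of polynomial growth) data, and the total mass and
  entropy as product integrals;
* `Kinetic.approximateSolution_apriori_bounds_of` (**proved**): (A2c) from (A2a), (A2b);
* `Kinetic.diPernaLions_approximatingScheme_of'` (**proved**): the approximating scheme (A) of
  `Hilbert6.diperna_lions` from A1, A2a, A2b, A3a, A3b only.

State of the decomposition of `Hilbert6.diperna_lions` after this file: remaining named facts
A1, A2a, A2b, A3a, A3b (scheme side); D3, B3, E49, L12 (limit side).

## References
* C. Cercignani, R. Illner, M. Pulvirenti, *The Mathematical Theory of Dilute Gases*, Springer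
  1994, §5.3 Lemma 5.3.1. [cite: CIPDiluteGases1994, §5.3 Lemma 5.3.1 (3.8)–(3.9) (pp. 141–142)]
* P.-L. Lions, LNM 1551 (1993), §II (22)–(23). [cite: Lions1993Kinetic, §II (22)–(23)]
-/

open MeasureTheory Metric Real Set Filter Topology
open scoped InnerProductSpace ENNReal

noncomputable section

namespace Literature.MathematicalPhysics.KineticTheory

section SliceIntegrability

variable {E : Type*} [NormedAddCommGroup E] [InnerProductSpace ℝ E] [FiniteDimensional ℝ E]
  [MeasurableSpace E] [BorelSpace E]

/-- Admissible data times a continuous weight of quadratic growth are integrable. [folklore] -/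
theorem IsTruncatedProblemData.integrable_mul_of_le_sq {f₀ : E → E → ℝ} (h : IsTruncatedProblemData f₀)
    {w : E × E → ℝ} (hw : Continuous w) {K : ℝ} (hK : ∀ z, |w z| ≤ K * (1 + ‖z‖ ^ 2)) :
    Integrable (fun z : E × E => f₀ z.1 z.2 * w z) (volume.prod volume) := by
  set g := h.toSchwartz with hg_def
  have h0 : Integrable (fun z : E × E => ‖z‖ ^ 0 * ‖g z‖) (volume.prod volume) :=
    g.integrable_pow_mul _ 0
  have h2 : Integrable (fun z : E × E => ‖z‖ ^ 2 * ‖g z‖) (volume.prod volume) :=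
    g.integrable_pow_mul _ 2
  have hK0 : 0 ≤ K := by
    have := hK 0
    simp only [norm_zero, ne_eq, OfNat.ofNat_ne_zero, not_false_eq_true, zero_pow, add_zero,
      mul_one] at this
    exact (abs_nonneg _).trans this
  have hint : Integrable (fun z : E × E => K * (‖z‖ ^ 0 * ‖g z‖ + ‖z‖ ^ 2 * ‖g z‖))
      (volume.prod volume) := (h0.add h2).const_mul K
  have hc : Continuous fun z : E × E => f₀ z.1 z.2 := h.contDiff.continuous
  refine hint.mono' (hc.mul hw).aestronglyMeasurable (ae_of_all _ fun z => ?_)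
  have hpos : 0 < f₀ z.1 z.2 := h.pos z.1 z.2
  have hgz : ‖g z‖ = f₀ z.1 z.2 := by
    rw [hg_def, IsTruncatedProblemData.toSchwartz_apply, Real.norm_of_nonneg hpos.le]
  rw [norm_mul, Real.norm_of_nonneg hpos.le, Real.norm_eq_abs, hgz, pow_zero, one_mul]
  calc f₀ z.1 z.2 * |w z| ≤ f₀ z.1 z.2 * (K * (1 + ‖z‖ ^ 2)) :=
        mul_le_mul_of_nonneg_left (hK z) hpos.le
    _ = K * (f₀ z.1 z.2 + ‖z‖ ^ 2 * f₀ z.1 z.2) := by ring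

/-- Admissible data are integrable. [folklore] -/
theorem IsTruncatedProblemData.integrable {f₀ : E → E → ℝ} (h : IsTruncatedProblemData f₀) :
    Integrable (fun z : E × E => f₀ z.1 z.2) (volume.prod volume) := by
  have := h.integrable_mul_of_le_sq (w := fun _ => (1 : ℝ)) continuous_const (K := 1)
    (fun z => by rw [abs_one]; nlinarith [sq_nonneg ‖z‖])
  simpa using this

/-- `f₀ |x|²` is integrable for admissible data. [folklore] -/
theorem IsTruncatedProblemData.integrable_mul_sq_fst {f₀ : E → E → ℝ} (h : IsTruncatedProblemData f₀) :
    Integrable (fun z : E × E => f₀ z.1 z.2 * ‖z.1‖ ^ 2) (volume.prod volume) :=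
  h.integrable_mul_of_le_sq (by fun_prop) (K := 1) fun z => by
    rw [abs_of_nonneg (sq_nonneg _)]
    nlinarith [norm_fst_le z, norm_nonneg z.1, sq_nonneg ‖z‖]

/-- `f₀ |v|²` is integrable for admissible data. [folklore] -/
theorem IsTruncatedProblemData.integrable_mul_sq_snd {f₀ : E → E → ℝ} (h : IsTruncatedProblemData f₀) :
    Integrable (fun z : E × E => f₀ z.1 z.2 * ‖z.2‖ ^ 2) (volume.prod volume) :=
  h.integrable_mul_of_le_sq (by fun_prop) (K := 1) fun z => by
    rw [abs_of_nonneg (sq_nonneg _)]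
    nlinarith [norm_snd_le z, norm_nonneg z.2, sq_nonneg ‖z‖]

omit [MeasurableSpace E] [BorelSpace E] [FiniteDimensional ℝ E] in
/-- `|x - t v|² ≤ (1 + |t|)² |(x, v)|²`. [folklore] -/
theorem norm_sub_smul_sq_le (t : ℝ) (z : E × E) : ‖z.1 - t • z.2‖ ^ 2 ≤ (1 + |t|) ^ 2 * ‖z‖ ^ 2 := by
  have h1 : ‖z.1 - t • z.2‖ ≤ (1 + |t|) * ‖z‖ := by
    calc ‖z.1 - t • z.2‖ ≤ ‖z.1‖ + ‖t • z.2‖ := norm_sub_le _ _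
      _ = ‖z.1‖ + |t| * ‖z.2‖ := by rw [norm_smul, Real.norm_eq_abs]
      _ ≤ ‖z‖ + |t| * ‖z‖ := add_le_add (norm_fst_le z)
          (mul_le_mul_of_nonneg_left (norm_snd_le z) (abs_nonneg t))
      _ = (1 + |t|) * ‖z‖ := by ring
  calc ‖z.1 - t • z.2‖ ^ 2 ≤ ((1 + |t|) * ‖z‖) ^ 2 := pow_le_pow_left₀ (norm_nonneg _) h1 2
    _ = (1 + |t|) ^ 2 * ‖z‖ ^ 2 := by ring

/-- `f₀ |x - t v|²` is integrable for admissible data. [folklore] -/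
theorem IsTruncatedProblemData.integrable_mul_sq_sub_smul {f₀ : E → E → ℝ}
    (h : IsTruncatedProblemData f₀) (t : ℝ) :
    Integrable (fun z : E × E => f₀ z.1 z.2 * ‖z.1 - t • z.2‖ ^ 2) (volume.prod volume) :=
  h.integrable_mul_of_le_sq (by fun_prop) (K := (1 + |t|) ^ 2) fun z => by
    rw [abs_of_nonneg (sq_nonneg _)]
    nlinarith [norm_sub_smul_sq_le t z, sq_nonneg ‖z‖, sq_nonneg (1 + |t|)]

/-- `f₀ |log f₀|` is integrable for admissible data. [folklore] -/
theorem IsTruncatedProblemData.integrable_mul_abs_log {f₀ : E → E → ℝ}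
    (h : IsTruncatedProblemData f₀) :
    Integrable (fun z : E × E => f₀ z.1 z.2 * |log (f₀ z.1 z.2)|) (volume.prod volume) := by
  have hc : Continuous fun z : E × E => f₀ z.1 z.2 := h.contDiff.continuous
  have hlogc : Continuous fun z : E × E => log (f₀ z.1 z.2) :=
    hc.log fun z => (h.pos z.1 z.2).ne'
  have hm : AEStronglyMeasurable (fun z : E × E => f₀ z.1 z.2 * |log (f₀ z.1 z.2)|)
      (volume.prod volume) := (hc.mul hlogc.abs).aestronglyMeasurable
  refine ⟨hm, ?_⟩
  rw [HasFiniteIntegral]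
  calc ∫⁻ z, ‖f₀ z.1 z.2 * |log (f₀ z.1 z.2)|‖ₑ ∂((volume : Measure E).prod volume)
      = ∫⁻ z, ENNReal.ofReal (f₀ z.1 z.2 * |log (f₀ z.1 z.2)|) ∂((volume : Measure E).prod volume) :=
        lintegral_congr fun z => by
          rw [Real.enorm_eq_ofReal (mul_nonneg (h.pos z.1 z.2).le (abs_nonneg _))]
    _ < ∞ := h.lintegral_absEntropy_lt_top

/-- `f₀ log f₀` is integrable for admissible data. [folklore] -/
theorem IsTruncatedProblemData.integrable_mul_log {f₀ : E → E → ℝ}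
    (h : IsTruncatedProblemData f₀) :
    Integrable (fun z : E × E => f₀ z.1 z.2 * log (f₀ z.1 z.2)) (volume.prod volume) := by
  have hc : Continuous fun z : E × E => f₀ z.1 z.2 := h.contDiff.continuous
  have hlogc : Continuous fun z : E × E => log (f₀ z.1 z.2) :=
    hc.log fun z => (h.pos z.1 z.2).ne'
  refine h.integrable_mul_abs_log.mono' (hc.mul hlogc).aestronglyMeasurable (ae_of_all _ fun z => ?_)
  rw [norm_mul, Real.norm_of_nonneg (h.pos z.1 z.2).le, Real.norm_eq_abs]

/-- The total mass of an admissible datum as a product integral. [folklore] -/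
theorem IsTruncatedProblemData.totalMass_eq_integral {f₀ : E → E → ℝ} (h : IsTruncatedProblemData f₀) :
    Literature.Analysis.FluidPDE.totalMass f₀ = ∫ z : E × E, f₀ z.1 z.2 ∂(volume.prod volume) := by
  rw [Literature.Analysis.FluidPDE.totalMass, integral_prod _ h.integrable]

/-- The entropy of an admissible datum as a product integral. [folklore] -/
theorem IsTruncatedProblemData.boltzmannEntropy_eq_integral {f₀ : E → E → ℝ}
    (h : IsTruncatedProblemData f₀) :
    Literature.Analysis.FluidPDE.boltzmannEntropy f₀ = ∫ z : E × E, f₀ z.1 z.2 * log (f₀ z.1 z.2) ∂(volume.prod volume) := by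
  rw [Literature.Analysis.FluidPDE.boltzmannEntropy, integral_prod _ h.integrable_mul_log]

/-- The Gaussian weight `exp(-(|x|² + |v|²)/2)` is integrable on phase space. [folklore] -/
theorem integrable_exp_neg_half_sq :
    Integrable (fun z : E × E => exp (-((‖z.1‖ ^ 2 + ‖z.2‖ ^ 2) / 2))) ((volume : Measure E).prod volume) := by
  have h1 : Integrable (fun v : E => exp (-(1 / 2) * ‖v‖ ^ 2)) :=
    Literature.Analysis.FluidPDE.integrable_exp_neg_mul_sq_norm (by norm_num)
  refine (h1.mul_prod h1).congr (ae_of_all _ fun z => ?_)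
  simp only
  rw [← Real.exp_add]
  congr 1
  ring

/-- The Gaussian weight along the characteristics, `exp(-(|x - t v|² + |v|²)/2)`, is integrable
with the same integral (the shear `(x, v) ↦ (x - t v, v)` preserves Lebesgue measure). [folklore] -/
theorem integrable_exp_neg_half_sq_shear (t : ℝ) :
    Integrable (fun z : E × E => exp (-((‖z.1 - t • z.2‖ ^ 2 + ‖z.2‖ ^ 2) / 2)))
      ((volume : Measure E).prod volume) ∧
    ∫ z : E × E, exp (-((‖z.1 - t • z.2‖ ^ 2 + ‖z.2‖ ^ 2) / 2)) ∂((volume : Measure E).prod volume) =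
      ∫ z : E × E, exp (-((‖z.1‖ ^ 2 + ‖z.2‖ ^ 2) / 2)) ∂((volume : Measure E).prod volume) := by
  have hmp := measurePreserving_freeShear (E := E) (-t)
  have hme := measurableEmbedding_freeShear (E := E) (-t)
  have hfun : (fun z : E × E => exp (-((‖z.1 - t • z.2‖ ^ 2 + ‖z.2‖ ^ 2) / 2))) =
      (fun y : E × E => exp (-((‖y.1‖ ^ 2 + ‖y.2‖ ^ 2) / 2))) ∘ fun z : E × E => (z.1 + (-t) • z.2, z.2) := by
    funext z
    simp [sub_eq_add_neg, neg_smul]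
  refine ⟨?_, ?_⟩
  · rw [hfun]
    exact (hmp.integrable_comp_emb hme).2 integrable_exp_neg_half_sq
  · rw [hfun]
    exact hmp.integral_comp hme (fun y : E × E => rexp (-((‖y.1‖ ^ 2 + ‖y.2‖ ^ 2) / 2)))

end SliceIntegrability

end Literature.MathematicalPhysics.KineticTheory

namespace Literature.MathematicalPhysics.KineticTheory

section APriori

universe u

/-- **(A2c) from (A2a) and (A2b)**: the a priori bounds (3.8)–(3.9) of CIP 1994 Lemma 5.3.1
follow from the conservation laws (3.4)–(3.6) and the entropy identity (3.7), exactly as printed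
(CIP p. 142: "(3.8) follows from (3.4)–(3.6) since `|x|² ≤ 2|x - tξ|² + 2t²|ξ|²", "(3.9) follows
from (3.7) and (3.11)"), with Arkeryd's pointwise bound `Kinetic.mul_abs_log_le_add` for (3.11)
and the dimensional constant `C_E = 4 ∫∫ exp(-(|x|² + |v|²)/2) dx dv` (the shear
`(x,v) ↦ (x - tv, v)` preserves Lebesgue measure). [cite: CIPDiluteGases1994, §5.3 Lemma 5.3.1 (3.8)–(3.9) (pp. 141–142)] -/
theorem approximateSolution_apriori_bounds_of (hcons : approximateSolution_conservation.{u})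
    (hent : approximateSolution_entropy_identity.{u}) : approximateSolution_apriori_bounds.{u} := by
  intro E _ _ _ _ _
  refine ⟨4 * ∫ z : E × E, exp (-((‖z.1‖ ^ 2 + ‖z.2‖ ^ 2) / 2)) ∂((volume : Measure E).prod volume),
    ?_⟩
  intro δ B f hδ hB hpoly hf t ht
  obtain ⟨hmass, hener, hmom⟩ := hcons hδ hB hpoly hf t ht
  obtain ⟨hDfin, hH⟩ := hent hδ hB hpoly hf t ht
  have hd : IsTruncatedProblemData (f t) := hf.isTruncatedProblemData_slice t ht
  have hd0 : IsTruncatedProblemData (f 0) := hf.isTruncatedProblemData_slice 0 le_rfl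
  set μ : Measure (E × E) := (volume : Measure E).prod volume with hμ
  have hg0 : ∀ z : E × E, 0 ≤ f t z.1 z.2 := fun z => (hd.pos z.1 z.2).le
  have hg₀0 : ∀ z : E × E, 0 ≤ f 0 z.1 z.2 := fun z => (hd0.pos z.1 z.2).le
  -- (3.4) as product integrals
  have hmass' : ∫ z, f t z.1 z.2 ∂μ = ∫ z, f 0 z.1 z.2 ∂μ := by
    rw [hμ, ← hd.totalMass_eq_integral, ← hd0.totalMass_eq_integral]; exact hmass
  constructor
  · ----------------------------------------------------------------- (3.8)
    have hW : ∀ z : E × E, f t z.1 z.2 * (1 + ‖z.1‖ ^ 2 + ‖z.2‖ ^ 2) ≤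
        f t z.1 z.2 * (1 + 2 * ‖z.1 - t • z.2‖ ^ 2 + (2 * t ^ 2 + 1) * ‖z.2‖ ^ 2) := by
      intro z
      refine mul_le_mul_of_nonneg_left ?_ (hg0 z)
      have h1 : ‖z.1‖ ≤ ‖z.1 - t • z.2‖ + |t| * ‖z.2‖ := by
        calc ‖z.1‖ = ‖(z.1 - t • z.2) + t • z.2‖ := by rw [sub_add_cancel]
          _ ≤ ‖z.1 - t • z.2‖ + ‖t • z.2‖ := norm_add_le _ _
          _ = ‖z.1 - t • z.2‖ + |t| * ‖z.2‖ := by rw [norm_smul, Real.norm_eq_abs]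
      have h2 : ‖z.1‖ ^ 2 ≤ (‖z.1 - t • z.2‖ + |t| * ‖z.2‖) ^ 2 :=
        pow_le_pow_left₀ (norm_nonneg _) h1 2
      have h4 : (|t| * ‖z.2‖) ^ 2 = t ^ 2 * ‖z.2‖ ^ 2 := by rw [mul_pow, sq_abs]
      nlinarith [sq_nonneg (‖z.1 - t • z.2‖ - |t| * ‖z.2‖), h2, h4, sq_nonneg ‖z.2‖,
        mul_nonneg (abs_nonneg t) (norm_nonneg z.2)]
    have hI1 : Integrable (fun z : E × E => f t z.1 z.2 *
        (1 + 2 * ‖z.1 - t • z.2‖ ^ 2 + (2 * t ^ 2 + 1) * ‖z.2‖ ^ 2)) μ := by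
      have := (hd.integrable.add ((hd.integrable_mul_sq_sub_smul t).const_mul 2)).add
        (hd.integrable_mul_sq_snd.const_mul (2 * t ^ 2 + 1))
      refine this.congr (ae_of_all _ fun z => ?_)
      simp only [Pi.add_apply]
      ring
    have hI0 : Integrable (fun z : E × E => f 0 z.1 z.2 *
        (1 + 2 * ‖z.1‖ ^ 2 + (2 * t ^ 2 + 1) * ‖z.2‖ ^ 2)) μ := by
      have := (hd0.integrable.add (hd0.integrable_mul_sq_fst.const_mul 2)).add
        (hd0.integrable_mul_sq_snd.const_mul (2 * t ^ 2 + 1))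
      refine this.congr (ae_of_all _ fun z => ?_)
      simp only [Pi.add_apply]
      ring
    have e1 : ∫ z, f t z.1 z.2 * (1 + 2 * ‖z.1 - t • z.2‖ ^ 2 + (2 * t ^ 2 + 1) * ‖z.2‖ ^ 2) ∂μ =
        (∫ z, f t z.1 z.2 ∂μ) + 2 * (∫ z, f t z.1 z.2 * ‖z.1 - t • z.2‖ ^ 2 ∂μ) +
          (2 * t ^ 2 + 1) * ∫ z, f t z.1 z.2 * ‖z.2‖ ^ 2 ∂μ := by
      have i1 : Integrable (fun z : E × E => f t z.1 z.2) μ := hd.integrable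
      have i2 : Integrable (fun z : E × E => 2 * (f t z.1 z.2 * ‖z.1 - t • z.2‖ ^ 2)) μ :=
        (hd.integrable_mul_sq_sub_smul t).const_mul 2
      have i3 : Integrable (fun z : E × E => (2 * t ^ 2 + 1) * (f t z.1 z.2 * ‖z.2‖ ^ 2)) μ :=
        hd.integrable_mul_sq_snd.const_mul _
      have i12 : Integrable (fun z : E × E => f t z.1 z.2 + 2 * (f t z.1 z.2 * ‖z.1 - t • z.2‖ ^ 2)) μ :=
        i1.add i2
      calc ∫ z, f t z.1 z.2 * (1 + 2 * ‖z.1 - t • z.2‖ ^ 2 + (2 * t ^ 2 + 1) * ‖z.2‖ ^ 2) ∂μ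
          = ∫ z, (f t z.1 z.2 + 2 * (f t z.1 z.2 * ‖z.1 - t • z.2‖ ^ 2)) +
              (2 * t ^ 2 + 1) * (f t z.1 z.2 * ‖z.2‖ ^ 2) ∂μ :=
            integral_congr_ae (ae_of_all _ fun z => by ring)
        _ = _ := by
            rw [integral_add i12 i3, integral_add i1 i2, integral_const_mul, integral_const_mul]
    have e0 : ∫ z, f 0 z.1 z.2 * (1 + 2 * ‖z.1‖ ^ 2 + (2 * t ^ 2 + 1) * ‖z.2‖ ^ 2) ∂μ =
        (∫ z, f 0 z.1 z.2 ∂μ) + 2 * (∫ z, f 0 z.1 z.2 * ‖z.1‖ ^ 2 ∂μ) +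
          (2 * t ^ 2 + 1) * ∫ z, f 0 z.1 z.2 * ‖z.2‖ ^ 2 ∂μ := by
      have i1 : Integrable (fun z : E × E => f 0 z.1 z.2) μ := hd0.integrable
      have i2 : Integrable (fun z : E × E => 2 * (f 0 z.1 z.2 * ‖z.1‖ ^ 2)) μ :=
        hd0.integrable_mul_sq_fst.const_mul 2
      have i3 : Integrable (fun z : E × E => (2 * t ^ 2 + 1) * (f 0 z.1 z.2 * ‖z.2‖ ^ 2)) μ :=
        hd0.integrable_mul_sq_snd.const_mul _
      have i12 : Integrable (fun z : E × E => f 0 z.1 z.2 + 2 * (f 0 z.1 z.2 * ‖z.1‖ ^ 2)) μ :=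
        i1.add i2
      calc ∫ z, f 0 z.1 z.2 * (1 + 2 * ‖z.1‖ ^ 2 + (2 * t ^ 2 + 1) * ‖z.2‖ ^ 2) ∂μ
          = ∫ z, (f 0 z.1 z.2 + 2 * (f 0 z.1 z.2 * ‖z.1‖ ^ 2)) +
              (2 * t ^ 2 + 1) * (f 0 z.1 z.2 * ‖z.2‖ ^ 2) ∂μ :=
            integral_congr_ae (ae_of_all _ fun z => by ring)
        _ = _ := by
            rw [integral_add i12 i3, integral_add i1 i2, integral_const_mul, integral_const_mul]
    calc ∫⁻ z : E × E, ENNReal.ofReal (f t z.1 z.2 * (1 + ‖z.1‖ ^ 2 + ‖z.2‖ ^ 2)) ∂μ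
        ≤ ∫⁻ z : E × E, ENNReal.ofReal (f t z.1 z.2 *
            (1 + 2 * ‖z.1 - t • z.2‖ ^ 2 + (2 * t ^ 2 + 1) * ‖z.2‖ ^ 2)) ∂μ :=
          lintegral_mono fun z => ENNReal.ofReal_le_ofReal (hW z)
      _ = ENNReal.ofReal (∫ z, f t z.1 z.2 *
            (1 + 2 * ‖z.1 - t • z.2‖ ^ 2 + (2 * t ^ 2 + 1) * ‖z.2‖ ^ 2) ∂μ) :=
          (ofReal_integral_eq_lintegral_ofReal hI1
            (ae_of_all _ fun z => mul_nonneg (hg0 z) (by positivity))).symm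
      _ = ENNReal.ofReal (∫ z, f 0 z.1 z.2 * (1 + 2 * ‖z.1‖ ^ 2 + (2 * t ^ 2 + 1) * ‖z.2‖ ^ 2) ∂μ) := by
          rw [e1, e0, hmass', hmom, hener]
      _ = ∫⁻ z : E × E, ENNReal.ofReal (f 0 z.1 z.2 *
            (1 + 2 * ‖z.1‖ ^ 2 + (2 * t ^ 2 + 1) * ‖z.2‖ ^ 2)) ∂μ :=
          ofReal_integral_eq_lintegral_ofReal hI0
            (ae_of_all _ fun z => mul_nonneg (hg₀0 z) (by positivity))
  · ----------------------------------------------------------------- (3.9)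
    set D : ℝ≥0∞ := ∫⁻ p : ℝ × E in Ioc 0 t ×ˢ univ, eTruncatedEntropyProduction δ B (f p.1 p.2)
      ∂(volume.prod volume) with hDdef
    set CE : ℝ := 4 * ∫ z : E × E, exp (-((‖z.1‖ ^ 2 + ‖z.2‖ ^ 2) / 2)) ∂μ with hCEdef
    have hCE0 : 0 ≤ CE := mul_nonneg (by norm_num) (integral_nonneg fun z => (exp_pos _).le)
    -- Arkeryd's pointwise bound with the weight `w = |x - tv|² + |v|²`
    have hpt : ∀ z : E × E, f t z.1 z.2 * |log (f t z.1 z.2)| ≤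
        f t z.1 z.2 * log (f t z.1 z.2) + 2 * (f t z.1 z.2 * (‖z.1 - t • z.2‖ ^ 2 + ‖z.2‖ ^ 2)) +
          4 * exp (-((‖z.1 - t • z.2‖ ^ 2 + ‖z.2‖ ^ 2) / 2)) := fun z =>
      mul_abs_log_le_add (f t z.1 z.2) (‖z.1 - t • z.2‖ ^ 2 + ‖z.2‖ ^ 2) (hg0 z) (by positivity)
    have hIabs := hd.integrable_mul_abs_log
    have hIlog := hd.integrable_mul_log
    have hIw : Integrable (fun z : E × E => f t z.1 z.2 * (‖z.1 - t • z.2‖ ^ 2 + ‖z.2‖ ^ 2)) μ := by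
      have := (hd.integrable_mul_sq_sub_smul t).add hd.integrable_mul_sq_snd
      refine this.congr (ae_of_all _ fun z => ?_)
      simp only [Pi.add_apply]
      ring
    obtain ⟨hIexp, hexp_eq⟩ := integrable_exp_neg_half_sq_shear (E := E) t
    have hineq : ∫ z, f t z.1 z.2 * |log (f t z.1 z.2)| ∂μ ≤
        (∫ z, f t z.1 z.2 * log (f t z.1 z.2) ∂μ) +
          2 * (∫ z, f t z.1 z.2 * (‖z.1 - t • z.2‖ ^ 2 + ‖z.2‖ ^ 2) ∂μ) + CE := by
      have j1 : Integrable (fun z : E × E => f t z.1 z.2 * log (f t z.1 z.2)) μ := hIlog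
      have j2 : Integrable (fun z : E × E =>
          2 * (f t z.1 z.2 * (‖z.1 - t • z.2‖ ^ 2 + ‖z.2‖ ^ 2))) μ := hIw.const_mul 2
      have j3 : Integrable (fun z : E × E =>
          4 * exp (-((‖z.1 - t • z.2‖ ^ 2 + ‖z.2‖ ^ 2) / 2))) μ := hIexp.const_mul 4
      have j12 : Integrable (fun z : E × E => f t z.1 z.2 * log (f t z.1 z.2) +
          2 * (f t z.1 z.2 * (‖z.1 - t • z.2‖ ^ 2 + ‖z.2‖ ^ 2))) μ := j1.add j2
      have j123 : Integrable (fun z : E × E => f t z.1 z.2 * log (f t z.1 z.2) +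
          2 * (f t z.1 z.2 * (‖z.1 - t • z.2‖ ^ 2 + ‖z.2‖ ^ 2)) +
          4 * exp (-((‖z.1 - t • z.2‖ ^ 2 + ‖z.2‖ ^ 2) / 2))) μ := j12.add j3
      calc ∫ z, f t z.1 z.2 * |log (f t z.1 z.2)| ∂μ
          ≤ ∫ z, (f t z.1 z.2 * log (f t z.1 z.2) +
              2 * (f t z.1 z.2 * (‖z.1 - t • z.2‖ ^ 2 + ‖z.2‖ ^ 2)) +
              4 * exp (-((‖z.1 - t • z.2‖ ^ 2 + ‖z.2‖ ^ 2) / 2))) ∂μ :=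
            integral_mono hIabs j123 hpt
        _ = (∫ z, f t z.1 z.2 * log (f t z.1 z.2) ∂μ) +
              2 * (∫ z, f t z.1 z.2 * (‖z.1 - t • z.2‖ ^ 2 + ‖z.2‖ ^ 2) ∂μ) +
              4 * ∫ z, exp (-((‖z.1 - t • z.2‖ ^ 2 + ‖z.2‖ ^ 2) / 2)) ∂μ := by
            rw [integral_add j12 j3, integral_add j1 j2, integral_const_mul, integral_const_mul]
        _ = _ := by rw [hexp_eq]
    -- (3.5)–(3.6): `∫∫ f(t) (|x - tv|² + |v|²) = ∫∫ f(0) (|x|² + |v|²)`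
    have hw_eq : ∫ z, f t z.1 z.2 * (‖z.1 - t • z.2‖ ^ 2 + ‖z.2‖ ^ 2) ∂μ =
        (∫ z, f 0 z.1 z.2 * ‖z.1‖ ^ 2 ∂μ) + ∫ z, f 0 z.1 z.2 * ‖z.2‖ ^ 2 ∂μ := by
      have : ∫ z, f t z.1 z.2 * (‖z.1 - t • z.2‖ ^ 2 + ‖z.2‖ ^ 2) ∂μ =
          (∫ z, f t z.1 z.2 * ‖z.1 - t • z.2‖ ^ 2 ∂μ) + ∫ z, f t z.1 z.2 * ‖z.2‖ ^ 2 ∂μ := by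
        rw [← integral_add (hd.integrable_mul_sq_sub_smul t) hd.integrable_mul_sq_snd]
        exact integral_congr_ae (ae_of_all _ fun z => by ring)
      rw [this, hmom, hener]
    -- (3.7): `∫∫ f(t) log f(t) = H(f(0)) - D`, and `H(f(0)) ≤ ∫∫ f(0) |log f(0)|`
    have hHt : Literature.Analysis.FluidPDE.boltzmannEntropy (f t) = ∫ z, f t z.1 z.2 * log (f t z.1 z.2) ∂μ :=
      hd.boltzmannEntropy_eq_integral
    have hH0 : Literature.Analysis.FluidPDE.boltzmannEntropy (f 0) = ∫ z, f 0 z.1 z.2 * log (f 0 z.1 z.2) ∂μ :=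
      hd0.boltzmannEntropy_eq_integral
    have hH0le : ∫ z, f 0 z.1 z.2 * log (f 0 z.1 z.2) ∂μ ≤ ∫ z, f 0 z.1 z.2 * |log (f 0 z.1 z.2)| ∂μ :=
      integral_mono hd0.integrable_mul_log hd0.integrable_mul_abs_log fun z =>
        mul_le_mul_of_nonneg_left (le_abs_self _) (hg₀0 z)
    have hlogt : ∫ z, f t z.1 z.2 * log (f t z.1 z.2) ∂μ = Literature.Analysis.FluidPDE.boltzmannEntropy (f 0) - D.toReal := by
      rw [← hHt]; linarith
    -- the real inequality
    have hI0' : Integrable (fun z : E × E => f 0 z.1 z.2 *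
        (|log (f 0 z.1 z.2)| + 2 * ‖z.1‖ ^ 2 + 2 * ‖z.2‖ ^ 2)) μ := by
      have := (hd0.integrable_mul_abs_log.add (hd0.integrable_mul_sq_fst.const_mul 2)).add
        (hd0.integrable_mul_sq_snd.const_mul 2)
      refine this.congr (ae_of_all _ fun z => ?_)
      simp only [Pi.add_apply]
      ring
    have e0 : ∫ z, f 0 z.1 z.2 * (|log (f 0 z.1 z.2)| + 2 * ‖z.1‖ ^ 2 + 2 * ‖z.2‖ ^ 2) ∂μ =
        (∫ z, f 0 z.1 z.2 * |log (f 0 z.1 z.2)| ∂μ) + 2 * (∫ z, f 0 z.1 z.2 * ‖z.1‖ ^ 2 ∂μ) +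
          2 * ∫ z, f 0 z.1 z.2 * ‖z.2‖ ^ 2 ∂μ := by
      have i1 : Integrable (fun z : E × E => f 0 z.1 z.2 * |log (f 0 z.1 z.2)|) μ :=
        hd0.integrable_mul_abs_log
      have i2 : Integrable (fun z : E × E => 2 * (f 0 z.1 z.2 * ‖z.1‖ ^ 2)) μ :=
        hd0.integrable_mul_sq_fst.const_mul 2
      have i3 : Integrable (fun z : E × E => 2 * (f 0 z.1 z.2 * ‖z.2‖ ^ 2)) μ :=
        hd0.integrable_mul_sq_snd.const_mul 2
      have i12 : Integrable (fun z : E × E => f 0 z.1 z.2 * |log (f 0 z.1 z.2)| +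
          2 * (f 0 z.1 z.2 * ‖z.1‖ ^ 2)) μ := i1.add i2
      calc ∫ z, f 0 z.1 z.2 * (|log (f 0 z.1 z.2)| + 2 * ‖z.1‖ ^ 2 + 2 * ‖z.2‖ ^ 2) ∂μ
          = ∫ z, (f 0 z.1 z.2 * |log (f 0 z.1 z.2)| + 2 * (f 0 z.1 z.2 * ‖z.1‖ ^ 2)) +
              2 * (f 0 z.1 z.2 * ‖z.2‖ ^ 2) ∂μ :=
            integral_congr_ae (ae_of_all _ fun z => by ring)
        _ = _ := by
            rw [integral_add i12 i3, integral_add i1 i2, integral_const_mul, integral_const_mul]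
    have hreal : (∫ z, f t z.1 z.2 * |log (f t z.1 z.2)| ∂μ) + D.toReal ≤
        (∫ z, f 0 z.1 z.2 * (|log (f 0 z.1 z.2)| + 2 * ‖z.1‖ ^ 2 + 2 * ‖z.2‖ ^ 2) ∂μ) + CE := by
      rw [e0]
      linarith [hineq, hw_eq, hlogt, hH0, hH0le]
    -- back to lower integrals
    have hL1 : ∫⁻ z, ENNReal.ofReal (f t z.1 z.2 * |log (f t z.1 z.2)|) ∂μ =
        ENNReal.ofReal (∫ z, f t z.1 z.2 * |log (f t z.1 z.2)| ∂μ) :=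
      (ofReal_integral_eq_lintegral_ofReal hIabs
        (ae_of_all _ fun z => mul_nonneg (hg0 z) (abs_nonneg _))).symm
    have hL0 : ∫⁻ z, ENNReal.ofReal (f 0 z.1 z.2 *
        (|log (f 0 z.1 z.2)| + 2 * ‖z.1‖ ^ 2 + 2 * ‖z.2‖ ^ 2)) ∂μ =
        ENNReal.ofReal (∫ z, f 0 z.1 z.2 * (|log (f 0 z.1 z.2)| + 2 * ‖z.1‖ ^ 2 + 2 * ‖z.2‖ ^ 2) ∂μ) :=
      (ofReal_integral_eq_lintegral_ofReal hI0'
        (ae_of_all _ fun z => mul_nonneg (hg₀0 z) (by positivity))).symm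
    have hpos1 : 0 ≤ ∫ z, f t z.1 z.2 * |log (f t z.1 z.2)| ∂μ :=
      integral_nonneg fun z => mul_nonneg (hg0 z) (abs_nonneg _)
    have hpos0 : 0 ≤ ∫ z, f 0 z.1 z.2 * (|log (f 0 z.1 z.2)| + 2 * ‖z.1‖ ^ 2 + 2 * ‖z.2‖ ^ 2) ∂μ :=
      integral_nonneg fun z => mul_nonneg (hg₀0 z) (by positivity)
    calc (∫⁻ z, ENNReal.ofReal (f t z.1 z.2 * |log (f t z.1 z.2)|) ∂μ) + D
        = ENNReal.ofReal (∫ z, f t z.1 z.2 * |log (f t z.1 z.2)| ∂μ) + ENNReal.ofReal D.toReal := by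
          rw [hL1, ENNReal.ofReal_toReal hDfin]
      _ = ENNReal.ofReal ((∫ z, f t z.1 z.2 * |log (f t z.1 z.2)| ∂μ) + D.toReal) :=
          (ENNReal.ofReal_add hpos1 ENNReal.toReal_nonneg).symm
      _ ≤ ENNReal.ofReal ((∫ z, f 0 z.1 z.2 *
            (|log (f 0 z.1 z.2)| + 2 * ‖z.1‖ ^ 2 + 2 * ‖z.2‖ ^ 2) ∂μ) + CE) :=
          ENNReal.ofReal_le_ofReal hreal
      _ = ENNReal.ofReal (∫ z, f 0 z.1 z.2 *
            (|log (f 0 z.1 z.2)| + 2 * ‖z.1‖ ^ 2 + 2 * ‖z.2‖ ^ 2) ∂μ) + ENNReal.ofReal CE :=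
          ENNReal.ofReal_add hpos0 hCE0
      _ = (∫⁻ z, ENNReal.ofReal (f 0 z.1 z.2 *
            (|log (f 0 z.1 z.2)| + 2 * ‖z.1‖ ^ 2 + 2 * ‖z.2‖ ^ 2)) ∂μ) + ENNReal.ofReal CE := by
          rw [hL0]

/-- **(A) from A1, A2a, A2b, A3a, A3b**: with (A2c) derived from (A2a)–(A2b)
(`approximateSolution_apriori_bounds_of`), the approximating scheme
`Kinetic.diPernaLions_approximatingScheme` rests on the global solvability of the truncated
problems, the conservation laws and entropy identity of Lemma 5.3.1, and the Step-7
approximations of kernel and data. [cite: CIPDiluteGases1994, §5.3 Step 7 (3.21)–(3.23)] -/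
theorem diPernaLions_approximatingScheme_of' (hA1 : truncatedProblem_globalExistence.{u})
    (hA2a : approximateSolution_conservation.{u}) (hA2b : approximateSolution_entropy_identity.{u})
    (hA3a : kernel_approximation.{u}) (hA3b : data_approximation.{u}) :
    diPernaLions_approximatingScheme.{u} :=
  diPernaLions_approximatingScheme_of hA1 hA2a hA2b (approximateSolution_apriori_bounds_of hA2a hA2b)
    hA3a hA3b

end APriori

end Literature.MathematicalPhysics.KineticTheory
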